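import Mathlib.AlgebraicGeometry.Morphisms.Etale
import Mathlib.AlgebraicGeometry.Morphisms.FiniteType
import Mathlib.AlgebraicGeometry.ResidueField
import Mathlib.RingTheory.AdicCompletion.LocalRing
import Mathlib.RingTheory.MvPolynomial.Basic
import HarnessLib

/-!
# Artin approximation in the étale-neighbourhood form (Artin 1969, Cor. 2.1)

Topic: `Literature/AlgebraicGeometry/Resolution`. M. Artin's algebraic approximation theorem,
in the form in which it is used to pass from complete local rings to étale neighbourhoods
(e.g. de Jong 1996, 4.25–4.28: the formal description of a normal crossings divisor versus the
étale-local Definition 2.4; toroidal embeddings; local structure of nodes):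

> "Throughout the section, `S` will denote a scheme which is of finite type over a field or
> over an excellent dedekind domain. Let `s` be a point of `S`. By *étale neighborhood* of `s`
> in `S` we mean an étale map `S' → S` together with a rational lifting of `s` to `S'`:
> `s = Spec k(s) → S'` [over `S`]. […] The henselization `𝒪̃_{S,s}` of the local ring of `S` at
> `s` is the limit of the rings `Γ(S', 𝒪_{S'})` as `S'` runs over the (filtering) category of
> etale neighborhoods. Thus theorem (1.10) translates immediately as
> **Corollary (2.1).** — Let `Y = (Y₁, …, Y_N)` be variables, and let
> `f = (f₁, …, f_m) ∈ 𝒪_S[Y]` be polynomials whose coefficients are global sections of `𝒪_S`.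
> Let `ȳ = (ȳ₁, …, ȳ_N)` be a solution of the system of equations `f(Y) = 0` in the complete
> local ring `𝒪̂_{S,s}`, and let `c` be an integer. There exists an etale neighborhood `S'` of
> `s` in `S`, and a solution `y = (y₁, …, y_N) ∈ Γ(S', 𝒪_{S'})` of the system of equations, such
> that `y ≡ ȳ (modulo 𝔪_s^c)`." (Artin 1969, p. 27)

* `Artin1969Corollary26` — NAMED FACT: Cor. 2.6 (isomorphic complete local rings over `k` ⇒ a
  common étale neighbourhood), for schemes of finite type over a field `k`; appended 2026-08-17
  for route `ResolutionOfSingularities/TeissierJung`.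
* `Artin1969EtaleApproximation` — NAMED FACT: Cor. 2.1 for `S` of finite type over a FIELD
  (the case of an excellent Dedekind base is not rendered). Its proof is Artin's Thm. 1.10 (the
  henselisation of a local ring essentially of finite type over a field has the approximation
  property; Néron desingularisation), equivalently Popescu's theorem with Stacks 07QY; it is a
  theory of its own and stays a named fact here.

Rendering. Variables and equations are indexed by arbitrary finite types. The complete local
ring is Mathlib's `AdicCompletion` of `𝒪_{S,s}` at `𝔪_s`; "solution in `𝒪̂_{S,s}`" evaluates
the polynomials through `Γ(S, 𝒪_S) → 𝒪_{S,s} → 𝒪̂_{S,s}`. An étale neighbourhood is an étale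
`e : S' → S` with a point `s'` over `s` whose residue field extension `κ(s) → κ(s')` is trivial
(this is the rational lifting `Spec κ(s) → S'`). The congruence `y ≡ ȳ (mod 𝔪_s^c)`, which
Artin reads in `𝒪̂_{S',s'} = 𝒪̂_{S,s}`, is rendered in `𝒪_{S',s'}`: for any `a ∈ 𝒪_{S,s}` with
`ȳ ≡ a (mod 𝔪̂_s^c)` (Mathlib `AdicCompletion.evalₐ`), the germ of `y` at `s'` is congruent to
the image of `a` modulo `𝔪_{s'}^c` (`= 𝔪_s^c 𝒪_{S',s'}`, `e` being unramified).

## Sources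

* M. Artin, *Algebraic approximation of structures over complete local rings*, Publ. Math.
  IHÉS 36 (1969) 23–58: Thm. 1.10, and §2, p. 27 (étale neighbourhoods, Cor. 2.1).
* The Stacks Project, Tag 07QY (approximation for henselian G-rings, via Popescu).
-/

noncomputable section

open CategoryTheory AlgebraicGeometry TopologicalSpace IsLocalRing

universe u

namespace Literature.AlgebraicGeometry.Resolution

/-- NAMED FACT — **Artin 1969, Cor. 2.1 (algebraic approximation over étale neighbourhoods)**,
for a scheme `S` of finite type over a field `k`: "Let `Y = (Y₁, …, Y_N)` be variables, and
let `f = (f₁, …, f_m) ∈ 𝒪_S[Y]` be polynomials whose coefficients are global sections of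
`𝒪_S`. Let `ȳ = (ȳ₁, …, ȳ_N)` be a solution of the system of equations `f(Y) = 0` in the
complete local ring `𝒪̂_{S,s}`, and let `c` be an integer. There exists an etale neighborhood
`S'` of `s` in `S` [an étale `S' → S` together with a rational lifting `Spec k(s) → S'` of
`s`], and a solution `y = (y₁, …, y_N) ∈ Γ(S', 𝒪_{S'})` of the system of equations, such that
`y ≡ ȳ (modulo 𝔪_s^c)`." Rendered: `f : S → Spec k` locally of finite type and quasi-compact;
`s : S` any point; finitely many polynomials `F j ∈ Γ(S, 𝒪_S)[Yᵢ]` (finite index types); a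
solution `ȳ` in `𝒪̂_{S,s} = AdicCompletion 𝔪_s 𝒪_{S,s}` (evaluation through
`Γ(S, 𝒪_S) → 𝒪_{S,s} → 𝒪̂_{S,s}`); conclusion: an étale `e : S' → S`, a point `s'` with
`e s' = s` and `κ(s) → κ(s')` onto (the rational lifting), global sections `yᵢ ∈ Γ(S', 𝒪_{S'})`
solving the equations pulled back along `e`, and the congruence: whenever `a ∈ 𝒪_{S,s}`
represents `ȳᵢ` modulo `𝔪̂_s^c`, the germ of `yᵢ` at `s'` minus the image of `a` lies in
`𝔪_{s'}^c`. (Artin allows also an excellent Dedekind domain as base; not rendered.) Users take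
`(h : Artin1969EtaleApproximation)`. [cite: Artin1969, Cor. 2.1, p. 27] -/
def Artin1969EtaleApproximation : Prop :=
  ∀ (k : Type u) [Field k] (S : Scheme.{u}) (f : S ⟶ Spec (.of k)),
    LocallyOfFiniteType f → QuasiCompact f →
      ∀ (s : S) (ι κ : Type) [Finite ι] [Finite κ] (F : κ → MvPolynomial ι Γ(S, ⊤))
        (ybar : ι → AdicCompletion (maximalIdeal (S.presheaf.stalk s)) (S.presheaf.stalk s))
        (c : ℕ),
        (∀ j, MvPolynomial.eval₂
            ((algebraMap (S.presheaf.stalk s)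
                (AdicCompletion (maximalIdeal (S.presheaf.stalk s)) (S.presheaf.stalk s))).comp
              (S.presheaf.germ ⊤ s trivial).hom) ybar (F j) = 0) →
          ∃ (S' : Scheme.{u}) (e : S' ⟶ S) (s' : S') (hs : e s' = s) (y : ι → Γ(S', ⊤)),
            Etale e ∧ Function.Surjective (e.residueFieldMap s') ∧
              (∀ j, MvPolynomial.eval₂ e.appTop.hom y (F j) = 0) ∧
                ∀ (i : ι) (a : S.presheaf.stalk s),
                  AdicCompletion.evalₐ (maximalIdeal (S.presheaf.stalk s)) c (ybar i) =
                      Ideal.Quotient.mk _ a →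
                    (S'.presheaf.germ ⊤ s' trivial).hom (y i) -
                        (e.stalkMap s').hom ((S.presheaf.stalkCongr (.of_eq hs.symm)).hom.hom a) ∈
                      maximalIdeal (S'.presheaf.stalk s') ^ c

/-! ## Elementary consequences -/

namespace Artin1969EtaleApproximation

/-- **Cor. 2.1 without the congruence**: solutions in the complete local ring give solutions
over some étale neighbourhood (take any `c`, e.g. `c = 0`). [cite: Artin1969, Cor. 2.1, p. 27] -/
theorem exists_etale_solution (h : Artin1969EtaleApproximation.{u}) {k : Type u} [Field k]
    {S : Scheme.{u}} (f : S ⟶ Spec (.of k)) [LocallyOfFiniteType f] [QuasiCompact f] (s : S)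
    {ι κ : Type} [Finite ι] [Finite κ]
    (F : κ → MvPolynomial ι Γ(S, ⊤))
    (ybar : ι → AdicCompletion (maximalIdeal (S.presheaf.stalk s)) (S.presheaf.stalk s))
    (hF : ∀ j, MvPolynomial.eval₂
        ((algebraMap (S.presheaf.stalk s)
            (AdicCompletion (maximalIdeal (S.presheaf.stalk s)) (S.presheaf.stalk s))).comp
          (S.presheaf.germ ⊤ s trivial).hom) ybar (F j) = 0) :
    ∃ (S' : Scheme.{u}) (e : S' ⟶ S) (s' : S') (_ : e s' = s) (y : ι → Γ(S', ⊤)),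
      Etale e ∧ Function.Surjective (e.residueFieldMap s') ∧
        ∀ j, MvPolynomial.eval₂ e.appTop.hom y (F j) = 0 := by
  obtain ⟨S', e, s', hs, y, he, hres, hy, -⟩ := h k S f ‹_› ‹_› s ι κ F ybar 0 hF
  exact ⟨S', e, s', hs, y, he, hres, hy⟩

end Artin1969EtaleApproximation

/-! ## Cor. 2.6: isomorphic complete local rings give a common étale neighbourhood -/

/-- NAMED FACT — **Artin 1969, Corollary (2.6)**: "Let `X₁, X₂` be `S`-schemes of finite type,
and let `xᵢ ∈ Xᵢ` be points. If the complete local rings `𝒪̂_{Xᵢ,xᵢ}` (`i = 1, 2`) are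
`𝒪_S`-isomorphic, then `X₁` and `X₂` are locally isomorphic for the etale topology. By this we
mean that there is a common etale neighborhood `(X', x')` of `xᵢ` in `Xᵢ`, i.e., a diagram of
etale maps `X₁ ← X' → X₂` sending `x' ↦ xᵢ` and inducing isomorphisms of residue fields
`κ(x₁) ≈ κ(x') ≈ κ(x₂)`." (Proof there: the isomorphism of complete local rings is a formal
`S`-map `X₁ → X₂`, approximated by Cor. 2.5 on an étale neighbourhood `X'` of `x₁` modulo `𝔪²`;
the approximation still induces an isomorphism of complete local rings, hence is étale at `x'`
by EGA IV 17.6.3.) Rendered for the base `S = Spec k`, `k` a field (§2: "`S` … of finite type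
over a field"; the excellent Dedekind case is not rendered): `fᵢ : Xᵢ → Spec k` locally of finite
type and quasi-compact; `xᵢ` arbitrary points; a ring isomorphism
`e : 𝒪̂_{X₁,x₁} ≃ 𝒪̂_{X₂,x₂}` of the `AdicCompletion`s at the maximal ideals commuting with the
two `k`-algebra structure maps `k = Γ(Spec k) → Γ(Xᵢ, ⊤) → 𝒪_{Xᵢ,xᵢ} → 𝒪̂_{Xᵢ,xᵢ}` (this is
"`𝒪_S`-isomorphic"); conclusion: a scheme `X'`, étale `eᵢ : X' → Xᵢ` with `e₁ ≫ f₁ = e₂ ≫ f₂`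
(a diagram of `S`-schemes) and a point `x'` with `eᵢ x' = xᵢ` at which both residue field maps
`κ(xᵢ) → κ(x')` are onto (isomorphisms of residue fields). Users take
`(h : Artin1969Corollary26)`; wanted by route `ResolutionOfSingularities/TeissierJung` (crux
`TeissierResolve`, line `Sketch`: formal diagonalizable-quotient models of the normalisation ⇒
étale charts for Bergh–Rydh 2019). [cite: Artin1969, Cor. 2.6, p. 28] -/
def Artin1969Corollary26 : Prop :=
  ∀ (k : Type u) [Field k] (X₁ X₂ : Scheme.{u}) (f₁ : X₁ ⟶ Spec (.of k)) (f₂ : X₂ ⟶ Spec (.of k)),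
    LocallyOfFiniteType f₁ → QuasiCompact f₁ → LocallyOfFiniteType f₂ → QuasiCompact f₂ →
      ∀ (x₁ : X₁) (x₂ : X₂)
        (e : AdicCompletion (maximalIdeal (X₁.presheaf.stalk x₁)) (X₁.presheaf.stalk x₁) ≃+*
          AdicCompletion (maximalIdeal (X₂.presheaf.stalk x₂)) (X₂.presheaf.stalk x₂)),
        (∀ a : k,
          e (algebraMap _ _ ((X₁.presheaf.germ ⊤ x₁ trivial).hom
              (f₁.appTop.hom ((Scheme.ΓSpecIso (.of k)).inv.hom a)))) =
            algebraMap _ _ ((X₂.presheaf.germ ⊤ x₂ trivial).hom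
              (f₂.appTop.hom ((Scheme.ΓSpecIso (.of k)).inv.hom a)))) →
        ∃ (X' : Scheme.{u}) (e₁ : X' ⟶ X₁) (e₂ : X' ⟶ X₂) (x' : X'),
          Etale e₁ ∧ Etale e₂ ∧ e₁.base x' = x₁ ∧ e₂.base x' = x₂ ∧ e₁ ≫ f₁ = e₂ ≫ f₂ ∧
            Function.Surjective (e₁.residueFieldMap x') ∧
              Function.Surjective (e₂.residueFieldMap x')

namespace Artin1969Corollary26

/-- **Cor. 2.6, the étale neighbourhood of `x₁` alone**: under the hypotheses of
`Artin1969Corollary26`, `x₁` has an étale neighbourhood `e₁ : X' → X₁` over `k` carrying an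
étale `k`-morphism `X' → X₂` that sends a point over `x₁` to `x₂` (forget the residue field
clause). [cite: Artin1969, Cor. 2.6, p. 28] -/
theorem exists_etale_nhd (h : Artin1969Corollary26.{u}) {k : Type u} [Field k]
    {X₁ X₂ : Scheme.{u}} (f₁ : X₁ ⟶ Spec (.of k)) (f₂ : X₂ ⟶ Spec (.of k))
    [LocallyOfFiniteType f₁] [QuasiCompact f₁] [LocallyOfFiniteType f₂] [QuasiCompact f₂]
    (x₁ : X₁) (x₂ : X₂)
    (e : AdicCompletion (maximalIdeal (X₁.presheaf.stalk x₁)) (X₁.presheaf.stalk x₁) ≃+*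
      AdicCompletion (maximalIdeal (X₂.presheaf.stalk x₂)) (X₂.presheaf.stalk x₂))
    (he : ∀ a : k,
      e (algebraMap _ _ ((X₁.presheaf.germ ⊤ x₁ trivial).hom
          (f₁.appTop.hom ((Scheme.ΓSpecIso (.of k)).inv.hom a)))) =
        algebraMap _ _ ((X₂.presheaf.germ ⊤ x₂ trivial).hom
          (f₂.appTop.hom ((Scheme.ΓSpecIso (.of k)).inv.hom a)))) :
    ∃ (X' : Scheme.{u}) (e₁ : X' ⟶ X₁) (e₂ : X' ⟶ X₂) (x' : X'),
      Etale e₁ ∧ Etale e₂ ∧ e₁.base x' = x₁ ∧ e₂.base x' = x₂ ∧ e₁ ≫ f₁ = e₂ ≫ f₂ := by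
  obtain ⟨X', e₁, e₂, x', h₁, h₂, h₃, h₄, h₅, -, -⟩ := h k X₁ X₂ f₁ f₂ ‹_› ‹_› ‹_› ‹_› x₁ x₂ e he
  exact ⟨X', e₁, e₂, x', h₁, h₂, h₃, h₄, h₅⟩

end Artin1969Corollary26

end Literature.AlgebraicGeometry.Resolution

end
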